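import Summits.NavierStokesRegularity.NavierStokesRegularity.Theses.CoriolisHead
import Literature.Analysis.FluidPDE.TsaiSelfSimilarBounded
import Literature.Analysis.FluidPDE.FlatSwirlGauge
import HarnessLib

/-!
# Route CoriolisHead · crux `NoCoRotatingCore` (stmt-NavierStokesRegularity-22676) —
# RUNG: no co-rotating core for HELICALLY SYMMETRIC rotated profiles

Support file (`--supports stmt-NavierStokesRegularity-22676`; theorems only, no definitions, no named
facts): a DECIDED SUB-CLASS (bc5 rung / T3 witness) of the open crux `NoCoRotatingCore`, widening the
axisymmetric rung of `CoriolisHeadNoCoRotatingCoreAxisymmetric` from rotations to SCREW MOTIONS.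

THE CLASS.  `U` is helically symmetric with respect to the frame rotation `B` (`Bx = β × x`) and a
pitch vector `c` iff it is equivariant under the screw motions `y ↦ e^{θB} y + θ c`; infinitesimally
the Lie derivative along the screw field `y ↦ By + c` vanishes:

  `DU(y)[By + c] = B U(y)`  for all `y`   (hypothesis `hscrew`; `c = 0` is the axisymmetric class,
  `c ∥ β` the classical helical flows, any constant `c` is allowed).

THE OBSERVATION.  On this class the Coriolis term of the rotated system is a constant drift,
`BU − DU[By] = DU[c]`, so the TRANSLATE `Ũ(z) = U(z − c/a)`, `P̃(z) = P(z − c/a)` solves Leray's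
NON-rotating profile system `−νΔŨ + aŨ + a DŨ[z] + DŨ[Ũ] + ∇P̃ = 0`, `div Ũ = 0`
(`isLerayProfile_translate_of_screw`: `a DU(y)[y] + DU(y)[c] = a DU(y)[y + c/a]`).  Tsai's theorem
for bounded Leray profiles (tree: `IsLerayProfile.exists_eq_const_of_bounded`) makes `Ũ`, hence `U`,
CONSTANT (`exists_eq_const_of_screw`), and the crux's conclusion holds with equality
(`noCoRotatingCore_of_screw`, binders = those of the crux plus `hscrew`).

HONEST FRAMING.  A decided special case, not the crux: `NoCoRotatingCore` (≡ bounded rotated-profile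
Liouville, Pineau–Vicol Conj. 1.1 strengthened) stays OPEN and Navier–Stokes regularity is NOT
proved.  THIN as a T3 witness (helical Navier–Stokes flows are classically regular,
Mahalov–Titi–Leibovich 1990); it records that a genuine rotated profile must break every screw
symmetry compatible with its frame.

References: T.-P. Tsai, ARMA 143 (1998) 29–51, Thm 1 [Tsai1998]; B. Pineau, V. Vicol,
arXiv:2607.09619, (1.8), Conj. 1.1 [PineauVicol2026]; A. Mahalov, E. S. Titi, S. Leibovich, Arch.
Rational Mech. Anal. 112 (1990) 193–222 [MahalovTitiLeibovich1990].
-/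

noncomputable section

-- the summit and its single sub-problem share the name (CONVENTIONS §1), as in every Theorems file
set_option linter.dupNamespace false

open scoped RealInnerProductSpace Laplacian ContDiff BigOperators
open Literature.Analysis.FluidPDE

namespace Summit.NavierStokesRegularity.NavierStokesRegularity.Theorems.CoriolisHead

section Screw

variable {ν a : ℝ} {B : EuclideanSpace ℝ (Fin 3) →L[ℝ] EuclideanSpace ℝ (Fin 3)}
  {U : EuclideanSpace ℝ (Fin 3) → EuclideanSpace ℝ (Fin 3)} {P : EuclideanSpace ℝ (Fin 3) → ℝ}
  {c : EuclideanSpace ℝ (Fin 3)}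

/-- **A helically symmetric rotated profile is a translated Leray profile.** If
`DU(y)[By + c] = BU(y)` for all `y` and `a ≠ 0`, then `(U(· − c/a), P(· − c/a))` solves Leray's
system `−νΔŨ + aŨ + a DŨ[z] + DŨ[Ũ] + ∇P̃ = 0`, `div Ũ = 0`. [cite: PineauVicol2026, (1.8) (p. 3)] -/
theorem isLerayProfile_translate_of_screw (ha : a ≠ 0) (hU : ContDiff ℝ (⊤ : ℕ∞) U)
    (hP : ContDiff ℝ 2 P) (hdiv : VectorCalculus.IsDivFree U)
    (heq : ∀ y, -(ν • Laplacian.laplacian U y) + a • U y + a • fderiv ℝ U y y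
      + (B (U y) - fderiv ℝ U y (B y)) + convect U U y + gradient P y = 0)
    (hscrew : ∀ y, fderiv ℝ U y (B y + c) = B (U y)) :
    IsLerayProfile ν a (fun z => U (z + -(a⁻¹ • c))) (fun z => P (z + -(a⁻¹ • c))) where
  contDiff_velocity := (hU.of_le (by norm_cast)).comp (contDiff_id.add contDiff_const)
  contDiff_pressure := (hP.of_le (by norm_num)).comp (contDiff_id.add contDiff_const)
  profile_eq z := by
    set y := z + -(a⁻¹ • c) with hy
    have hrot : B (U y) - fderiv ℝ U y (B y) = fderiv ℝ U y c := by
      have h := hscrew y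
      rw [map_add] at h
      rw [← h]
      abel
    have h := heq y
    rw [hrot] at h
    rw [laplacian_comp_add_const, fderiv_comp_add_right, gradient_comp_add_const]
    have hz : z = y + a⁻¹ • c := by rw [hy]; abel
    have hdrift : a • fderiv ℝ U y z = a • fderiv ℝ U y y + fderiv ℝ U y c := by
      rw [hz, map_add, smul_add, map_smul, smul_smul, mul_inv_cancel₀ ha, one_smul]
    show -(ν • Laplacian.laplacian U y) + a • U y + a • fderiv ℝ U y z
      + convect (fun z => U (z + -(a⁻¹ • c))) (fun z => U (z + -(a⁻¹ • c))) z
      + gradient P y = 0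
    have hconv : convect (fun z => U (z + -(a⁻¹ • c))) (fun z => U (z + -(a⁻¹ • c))) z
        = convect U U y := by
      rw [convect_apply, convect_apply, fderiv_comp_add_right]
    rw [hconv, hdrift, ← h]
    abel
  divFree z := by
    show VectorCalculus.divergence (fun w => U (w + -(a⁻¹ • c))) z = 0
    rw [VectorCalculus.divergence, fderiv_comp_add_right]
    exact hdiv _

/-- **Helically symmetric bounded rotated profiles are constant** (any `ν, a > 0`, skew `B`, pitch
`c`): Tsai's theorem for bounded Leray profiles applied to the translate. [cite: Tsai1998, Thm 1 (q = ∞, p. 31)] -/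
theorem exists_eq_const_of_screw (hν : 0 < ν) (ha : 0 < a) (hU : ContDiff ℝ (⊤ : ℕ∞) U)
    (hP : ContDiff ℝ 2 P) (hdiv : VectorCalculus.IsDivFree U)
    (heq : ∀ y, -(ν • Laplacian.laplacian U y) + a • U y + a • fderiv ℝ U y y
      + (B (U y) - fderiv ℝ U y (B y)) + convect U U y + gradient P y = 0)
    (hbdd : ∃ M : ℝ, ∀ y, ‖U y‖ ≤ M) (hscrew : ∀ y, fderiv ℝ U y (B y + c) = B (U y)) :
    ∃ b : EuclideanSpace ℝ (Fin 3), ∀ y, U y = b := by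
  obtain ⟨M, hM⟩ := hbdd
  obtain ⟨b, hb⟩ := (isLerayProfile_translate_of_screw ha.ne' hU hP hdiv heq hscrew).exists_eq_const_of_bounded
    hν ha ⟨M, fun z => hM _⟩
  refine ⟨b, fun y => ?_⟩
  have h := hb (y + a⁻¹ • c)
  simp only [add_neg_cancel_right] at h
  exact h

/-- On the helically symmetric class the velocity gradient vanishes identically.
[cite: Tsai1998, Thm 1 (q = ∞, p. 31)] -/
theorem fderiv_eq_zero_of_screw (hν : 0 < ν) (ha : 0 < a) (hU : ContDiff ℝ (⊤ : ℕ∞) U)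
    (hP : ContDiff ℝ 2 P) (hdiv : VectorCalculus.IsDivFree U)
    (heq : ∀ y, -(ν • Laplacian.laplacian U y) + a • U y + a • fderiv ℝ U y y
      + (B (U y) - fderiv ℝ U y (B y)) + convect U U y + gradient P y = 0)
    (hbdd : ∃ M : ℝ, ∀ y, ‖U y‖ ≤ M) (hscrew : ∀ y, fderiv ℝ U y (B y + c) = B (U y))
    (y : EuclideanSpace ℝ (Fin 3)) : fderiv ℝ U y = 0 := by
  obtain ⟨b, hb⟩ := exists_eq_const_of_screw hν ha hU hP hdiv heq hbdd hscrew
  have hUc : U = fun _ => b := funext hb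
  rw [hUc]
  exact fderiv_const_apply b

end Screw

/-! ### The rung, in the binders of the crux -/

/-- **RUNG of `NoCoRotatingCore` (bc5 witness): no co-rotating core for HELICALLY SYMMETRIC rotated
profiles.**  The crux `CoriolisHead.NoCoRotatingCore` restricted to profiles equivariant under a
screw motion of the frame (`DU(y)[By + c] = BU(y)` for some constant pitch vector `c`; `c = 0`:
axisymmetric): for every `ν, a > 0`, skew `B`, and every smooth bounded divergence-free such solution
`(U, P)` of the rotated Leray profile system, `0 ≤ Σₗ (B ∂ₗU(y))ₗ` at every point (indeed `= 0`).
Same binders as the crux plus the one class hypothesis; the crux itself remains open.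
[cite: Tsai1998, Thm 1 (q = ∞, p. 31)] -/
theorem noCoRotatingCore_of_screw : ∀ (ν a : ℝ), 0 < ν → 0 < a →
    ∀ (B : EuclideanSpace ℝ (Fin 3) →L[ℝ] EuclideanSpace ℝ (Fin 3))
      (U : EuclideanSpace ℝ (Fin 3) → EuclideanSpace ℝ (Fin 3)) (P : EuclideanSpace ℝ (Fin 3) → ℝ),
      ContDiff ℝ (⊤ : ℕ∞) U → ContDiff ℝ 2 P → (∀ x, inner ℝ (B x) x = 0) →
      Literature.Analysis.FluidPDE.VectorCalculus.IsDivFree U →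
      (∀ y, -(ν • Laplacian.laplacian U y) + a • U y + a • fderiv ℝ U y y + (B (U y) - fderiv ℝ U y (B y))
        + Literature.Analysis.FluidPDE.convect U U y + gradient P y = 0) →
      (∃ M : ℝ, ∀ y, ‖U y‖ ≤ M) →
      (∃ c : EuclideanSpace ℝ (Fin 3), ∀ y, fderiv ℝ U y (B y + c) = B (U y)) →
      ∀ y, 0 ≤ ∑ l, (B (fderiv ℝ U y (EuclideanSpace.single l 1))) l := by
  intro ν a hν ha B U P hU hP _hB hdiv heq hbdd hscrew y
  obtain ⟨c, hc⟩ := hscrew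
  simp [fderiv_eq_zero_of_screw hν ha hU hP hdiv heq hbdd hc y]

end Summit.NavierStokesRegularity.NavierStokesRegularity.Theorems.CoriolisHead

end
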